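import Summits.CriticalPhenomena.PercolationContinuityZ3.Theorems.PercNearOneGluingNoHeavyLowerTailSahiLatinIndep
import Summits.CriticalPhenomena.PercolationContinuityZ3.Theorems.PercNearOneGluingNoHeavyLowerTailSahiLatinFunctionals

/-!
# `NoHeavyLowerTail` (crux stmt-CriticalPhenomena-4575), Sahi programme (prim-master-conj gen 44): the SLACK CALCULUS of the Latin
# kernel — `κ(a,b,c) = HS(a∩c, b) + HS(a∩b, c) − Σ_{u∈a} KG_{bc}(u)`, the Kleitman gaps sum to the Harris slack, coefficientwise Harris,
# and the INDEPENDENT-PAIR FORMULA `κ(a,b,c) = HS(a∩c, b) + HS(a, b∩c)` for `a ⊥ b`, in EVERY dimension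

Support file (`--supports stmt-CriticalPhenomena-4575`; companion of `…SahiLatinKernel/Moves/Zeros/Indep`).  Memo
`run/shared/lean/prim/prim-l12/FROM-prim-master-conj-g44-*.md`; POINTWISE §45.  Everything proved; axioms standard; nothing is asserted
about the crux, and FBP does not enter.

With `hs_b(u) = 2^d[u∈b] − N_b(u)` (the coefficientwise-Harris CHARGE of `b`), `HS(X, b) = Σ_{u∈X} hs_b(u) = 2^d|X∩b| − #{Latin pairs in X×b}`
(the HARRIS SLACK; `HS(X,b) = HS(b,X)`, `HS_comm`) and the KLEITMAN GAP `KG_{bc}(u) = N_{b∩c}(u) − Λ_{bc}(u)` of the traces of `b, c` on the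
link of `u` (`≥ 0` for up-sets = the antipodal Harris inequality `Lam_le_N` of `…SahiLatinMoves`):
* `Phi_eq_hs` — the charge splits as `Φ_{bc}(u) = [u∈c]·hs_b(u) + [u∈b]·hs_c(u) − KG_{bc}(u)` (rewriting of `SahiLatin.Phi_eq`);
* `kappa_eq_HS` — **`κ(a,b,c) = HS(a∩c, b) + HS(a∩b, c) − Σ_{u∈a} KG_{bc}(u)`**;
* `HS_eq : HS(X,b) = 2^d|X∩b| − latinPairs X b`, `HS_comm`, **`sum_KG_eq_HS` — `Σ_u KG_{bc}(u) = HS(b,c)`** (double counting of `…SahiLatinHarris`), hence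
  `kappa_univ_eq_HS : κ(Ω,b,c) = HS(b,c)`, `HS_nonneg` (= coefficientwise Harris, `…SahiLatinHarris.kappa_univ_nonneg`), `HS_sub_kappa_eq`,
  `sum_KG_le_HS` (the gaps over any `a` are at most the slack) and `indep_of_HS_eq_zero` (`HS(b,c) = 0 ⟹ b ⊥ c`, from `…SahiLatinIndep`);
* `latinTriples_eq_of_indep` — for `a ⊥ b` the Latin triples through `a × b × c` are equinumerous with the Latin pairs through `(a∩b) × c`
  (`exch`: axiswise exchange of the first two points on the `a`-inessential axes), whence **`kappa_eq_of_indep : κ(a,b,c) = HS(a∩c, b) + HS(a, b∩c)`**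
  (the Sahi cell's `sStarD_eq_two_harrisSlacks_of_indepSlots`, here for an arbitrary index type and in the link vocabulary),
  `HS_eq_zero_of_indep` / **`HS_eq_zero_iff_indep`** (`HS(a,b) = 0 ⟺ a ⊥ b` for up-sets), `kappa_nonneg_of_indep`, `HS_eq_zero_of_indep_of_kappa_eq_zero` (for `a ⊥ b` up-sets: `κ = 0 ⟹ HS(a∩c,b) = 0 ∧ HS(a,b∩c) = 0`).
USE: `…SahiLatinTerminalSupport` (terminal triples: `ess(b∩c) = ess(b) ∪ ess(c)`; TZ ⟺ "a terminal zero has an independent pair").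
-/

namespace Summit.CriticalPhenomena.PercolationContinuityZ3.Theorems.SahiLatin

open Finset

variable {ι : Type*} [Fintype ι] [DecidableEq ι]

/-! ## §1  Charges, slacks, gaps; the split of `Φ` and of `κ` -/

/-- The coefficientwise-Harris CHARGE of `b` at `u`: `hs_b(u) = 2^d[u∈b] − N_b(u)`. [this work] -/
def hs (b : Finset (Pt ι)) (u : Pt ι) : ℤ := 2 ^ Fintype.card ι * ind b u - (N b u : ℤ)

/-- The HARRIS SLACK `HS(X, b) = Σ_{u∈X} hs_b(u)` (`= 2^d|X∩b| − #{Latin pairs in X × b}`). [this work] -/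
def HS (X b : Finset (Pt ι)) : ℤ := ∑ u ∈ X, hs b u

/-- The KLEITMAN GAP of the traces of `b, c` on the link of `u`: `KG_{bc}(u) = N_{b∩c}(u) − Λ_{bc}(u)` (an integer; `≥ 0` for up-sets). [this work] -/
def KG (b c : Finset (Pt ι)) (u : Pt ι) : ℤ := (N (b ∩ c) u : ℤ) - (Lam b c u : ℤ)

/-- `hs_b(u) = 2^d − N_b(u) ≥ 0`-part: on `b` the charge is `2^d − N_b(u)`. [this work] -/
theorem hs_of_mem {b : Finset (Pt ι)} {u : Pt ι} (h : u ∈ b) : hs b u = 2 ^ Fintype.card ι - (N b u : ℤ) := by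
  simp [hs, ind_of_mem h]

/-- Off `b` the charge is `−N_b(u)`. [this work] -/
theorem hs_of_not_mem {b : Finset (Pt ι)} {u : Pt ι} (h : u ∉ b) : hs b u = -(N b u : ℤ) := by
  simp [hs, ind_of_not_mem h]

/-- On `b` the charge is nonnegative. [this work] -/
theorem hs_nonneg_of_mem {b : Finset (Pt ι)} {u : Pt ι} (h : u ∈ b) : 0 ≤ hs b u := by
  rw [hs_of_mem h]
  have := N_le b u
  have h' : (N b u : ℤ) ≤ 2 ^ Fintype.card ι := by exact_mod_cast this
  linarith

/-- Off `b` the charge is nonpositive. [this work] -/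
theorem hs_nonpos_of_not_mem {b : Finset (Pt ι)} {u : Pt ι} (h : u ∉ b) : hs b u ≤ 0 := by
  rw [hs_of_not_mem h]
  have : (0 : ℤ) ≤ N b u := Nat.cast_nonneg _
  linarith

/-- For up-sets the Kleitman gap is nonnegative (antipodal Harris on the link, `Lam_le_N`). [this work] -/
theorem KG_nonneg {b c : Finset (Pt ι)} (hb : IsUpperSet (b : Set (Pt ι))) (hc : IsUpperSet (c : Set (Pt ι))) (u : Pt ι) :
    0 ≤ KG b c u := by
  have h : (Lam b c u : ℤ) ≤ N (b ∩ c) u := by exact_mod_cast Lam_le_N hb hc u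
  rw [KG]; linarith

/-- The gap is symmetric in `b, c`. [this work] -/
theorem KG_comm (b c : Finset (Pt ι)) (u : Pt ι) : KG b c u = KG c b u := by
  rw [KG, KG, inter_comm, Lam_comm]

/-- **The split of the charge**: `Φ_{bc}(u) = [u∈c]·hs_b(u) + [u∈b]·hs_c(u) − KG_{bc}(u)`. [this work] -/
theorem Phi_eq_hs (b c : Finset (Pt ι)) (u : Pt ι) : Phi b c u = ind c u * hs b u + ind b u * hs c u - KG b c u := by
  rw [Phi_eq, hs, hs, KG, pow_succ]; ring

/-- `Σ_{u∈a} [u∈c]·hs_b(u) = HS(a∩c, b)`. [this work] -/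
theorem sum_ind_mul_hs (a c b : Finset (Pt ι)) : ∑ u ∈ a, ind c u * hs b u = HS (a ∩ c) b := by
  rw [HS, ← sum_filter_add_sum_filter_not a (fun u => u ∈ c)]
  have h1 : ∑ u ∈ a.filter (fun u => u ∈ c), ind c u * hs b u = ∑ u ∈ a ∩ c, hs b u := by
    rw [filter_mem_eq_inter]
    exact sum_congr rfl fun u hu => by rw [ind_of_mem (mem_inter.1 hu).2, one_mul]
  have h2 : ∑ u ∈ a.filter (fun u => ¬ u ∈ c), ind c u * hs b u = 0 :=
    sum_eq_zero fun u hu => by rw [ind_of_not_mem (mem_filter.1 hu).2, zero_mul]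
  rw [h1, h2, add_zero]

/-- **The split of the kernel**: `κ(a,b,c) = HS(a∩c, b) + HS(a∩b, c) − Σ_{u∈a} KG_{bc}(u)`. [this work] -/
theorem kappa_eq_HS (a b c : Finset (Pt ι)) : kappa a b c = HS (a ∩ c) b + HS (a ∩ b) c - ∑ u ∈ a, KG b c u := by
  rw [kappa_eq_sum_Phi, sum_congr rfl (fun u _ => Phi_eq_hs b c u), sum_sub_distrib, sum_add_distrib, sum_ind_mul_hs, sum_ind_mul_hs]

/-! ## §2  Double counting (via `…SahiLatinHarris`): `HS` through `latinPairs`, `HS` is symmetric, `Σ_u KG_{bc}(u) = HS(b,c)` -/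

omit [DecidableEq ι] in
/-- `Σ_{u∈X} ind_b(u) = |X ∩ b|`. [this work] -/
theorem sum_ind_eq_card_inter (X b : Finset (Pt ι)) : ∑ u ∈ X, ind b u = ((X ∩ b).card : ℤ) := by
  rw [← sum_filter_add_sum_filter_not X (fun x => x ∈ b), filter_mem_eq_inter]
  have hz : ∑ x ∈ X.filter (fun x => ¬ x ∈ b), ind b x = 0 := sum_eq_zero fun x hx => ind_of_not_mem (mem_filter.1 hx).2
  rw [hz, add_zero, sum_congr rfl (fun x hx => ind_of_mem (mem_inter.1 hx).2), sum_const, nsmul_eq_mul, mul_one]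

/-- `Σ_{u∈X} N_b(u) = latinPairs X b` (the Latin pairs in `X × b`, `…SahiLatinHarris.sum_ind_mul_N`). [this work] -/
theorem sum_N_eq_latinPairs (X b : Finset (Pt ι)) : ∑ u ∈ X, (N b u : ℤ) = latinPairs X b := by
  rw [← sum_ind_mul_N b X, ← sum_filter_add_sum_filter_not univ (fun x => x ∈ X), filter_univ_mem]
  have hz : ∑ x ∈ univ.filter (fun x => ¬ x ∈ X), ind X x * (N b x : ℤ) = 0 :=
    sum_eq_zero fun x hx => by rw [ind_of_not_mem (mem_filter.1 hx).2, zero_mul]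
  rw [hz, add_zero]
  exact sum_congr rfl fun x hx => by rw [ind_of_mem hx, one_mul]

/-- `HS(X, b) = 2^d |X ∩ b| − latinPairs X b`. [this work] -/
theorem HS_eq (X b : Finset (Pt ι)) : HS X b = 2 ^ Fintype.card ι * (X ∩ b).card - latinPairs X b := by
  rw [HS]
  simp only [hs]
  rw [sum_sub_distrib, ← mul_sum, sum_ind_eq_card_inter, sum_N_eq_latinPairs]

/-- **`HS` is symmetric**: `HS(X, Y) = HS(Y, X)`. [this work] -/
theorem HS_comm (X Y : Finset (Pt ι)) : HS X Y = HS Y X := by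
  rw [HS_eq, HS_eq, inter_comm, latinPairs_comm]

/-- **THE KLEITMAN GAPS SUM TO THE HARRIS SLACK**: `Σ_u KG_{bc}(u) = HS(b, c)`. [this work] -/
theorem sum_KG_eq_HS (b c : Finset (Pt ι)) : ∑ u : Pt ι, KG b c u = HS b c := by
  simp only [KG]
  rw [sum_sub_distrib, sum_N, sum_Lam, HS_eq]

/-- **`κ(Ω, b, c) = HS(b, c)`**: the Harris slack is the kernel with a full slot (`…SahiLatinHarris.kappa_univ`). [this work] -/
theorem kappa_univ_eq_HS (b c : Finset (Pt ι)) : kappa univ b c = HS b c := by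
  rw [kappa_univ, ← sum_KG_eq_HS]
  simp only [KG]

/-- **COEFFICIENTWISE HARRIS** as `HS(b,c) ≥ 0` for up-sets (`…SahiLatinHarris.kappa_univ_nonneg`). [this work] -/
theorem HS_nonneg {b c : Finset (Pt ι)} (hb : IsUpperSet (b : Set (Pt ι))) (hc : IsUpperSet (c : Set (Pt ι))) : 0 ≤ HS b c := by
  rw [← kappa_univ_eq_HS]; exact kappa_univ_nonneg hb hc

/-- The gaps over any `a` are at most the slack: `Σ_{u∈a} KG_{bc}(u) ≤ HS(b,c)` for up-sets `b, c`. [this work] -/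
theorem sum_KG_le_HS (a : Finset (Pt ι)) {b c : Finset (Pt ι)} (hb : IsUpperSet (b : Set (Pt ι))) (hc : IsUpperSet (c : Set (Pt ι))) :
    ∑ u ∈ a, KG b c u ≤ HS b c := by
  rw [← sum_KG_eq_HS]
  exact sum_le_sum_of_subset_of_nonneg (subset_univ a) fun u _ _ => KG_nonneg hb hc u

/-- `HS(b,c) = 0 ⟹ b ⊥ c` for up-sets (`…SahiLatinIndep.indep_of_kappa_univ_eq_zero`). [this work] -/
theorem indep_of_HS_eq_zero {b c : Finset (Pt ι)} (hb : IsUpperSet (b : Set (Pt ι))) (hc : IsUpperSet (c : Set (Pt ι)))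
    (h : HS b c = 0) : Indep b c :=
  indep_of_kappa_univ_eq_zero hb hc (by rw [kappa_univ_eq_HS, h])

/-- The outside charge: `HS(b,c) − κ(a,b,c) = Σ_{u∉a} Φ_{bc}(u)` (first-point form with a full slot). [this work] -/
theorem HS_sub_kappa_eq (a b c : Finset (Pt ι)) : HS b c - kappa a b c = ∑ u ∈ aᶜ, Phi b c u := by
  rw [← kappa_univ_eq_HS, kappa_eq_sum_Phi, kappa_eq_sum_Phi, ← sum_compl_add_sum a]; ring

/-- A trivial lower bound from the split: `κ(a,b,c) ≥ HS(a∩c,b) + HS(a∩b,c) − HS(b,c)` for up-sets `b, c`. [this work] -/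
theorem kappa_ge_HS_sub (a : Finset (Pt ι)) {b c : Finset (Pt ι)} (hb : IsUpperSet (b : Set (Pt ι))) (hc : IsUpperSet (c : Set (Pt ι))) :
    HS (a ∩ c) b + HS (a ∩ b) c - HS b c ≤ kappa a b c := by
  rw [kappa_eq_HS]
  have := sum_KG_le_HS a hb hc
  linarith

/-! ## §3  The independent-pair formula -/

section Indep

/-- Axiswise exchange of the first two points of a Latin triple on the axes of a set `P`. [this work] -/
def exch (P : Finset ι) : LPerm ι ≃ LPerm ι where
  toFun ρ i := if i ∈ P then ρ i * Equiv.swap 0 1 else ρ i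
  invFun ρ i := if i ∈ P then ρ i * Equiv.swap 0 1 else ρ i
  left_inv ρ := by
    funext i
    by_cases hi : i ∈ P
    · simp only [hi, if_true, mul_assoc, Equiv.swap_mul_self, mul_one]
    · simp only [hi, if_false]
  right_inv ρ := by
    funext i
    by_cases hi : i ∈ P
    · simp only [hi, if_true, mul_assoc, Equiv.swap_mul_self, mul_one]
    · simp only [hi, if_false]

omit [Fintype ι] in
/-- The exchanged triple: first point. [this work] -/
theorem lpt_exch_zero (P : Finset ι) (ρ : LPerm ι) (i : ι) : lpt (exch P ρ) 0 i = if i ∈ P then lpt ρ 1 i else lpt ρ 0 i := by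
  by_cases hi : i ∈ P <;> simp [exch, lpt, hi, Equiv.Perm.mul_apply, Equiv.swap_apply_left]

omit [Fintype ι] in
/-- The exchanged triple: third point unchanged. [this work] -/
theorem lpt_exch_two (P : Finset ι) (ρ : LPerm ι) : lpt (exch P ρ) 2 = lpt ρ 2 := by
  funext i
  have h2 : Equiv.swap (0 : Fin 3) 1 2 = 2 := by decide
  by_cases hi : i ∈ P <;> simp [exch, lpt, hi, Equiv.Perm.mul_apply, h2]

/-- **The Latin-triple count for an independent pair**: if `a ⊥ b` then
`#{Latin (x,y,z) : x∈a, y∈b, z∈c} = #{Latin (w,·,z) : w ∈ a∩b, z ∈ c}` — exchange `x` and `y` on the `a`-inessential axes. [this work] -/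
theorem sum_lpt_abc_eq_of_indep {a b : Finset (Pt ι)} (hab : Indep a b) (c : Finset (Pt ι)) :
    ∑ ρ : LPerm ι, ind a (lpt ρ 0) * ind b (lpt ρ 1) * ind c (lpt ρ 2) =
      ∑ ρ : LPerm ι, ind a (lpt ρ 0) * ind b (lpt ρ 0) * ind c (lpt ρ 2) := by
  classical
  set P : Finset ι := univ.filter fun i => AxisInessential a i with hP
  rw [← Equiv.sum_comp (exch P) (fun ρ => ind a (lpt ρ 0) * ind b (lpt ρ 0) * ind c (lpt ρ 2))]
  refine sum_congr rfl fun ρ _ => ?_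
  have ha : lpt ρ 0 ∈ a ↔ lpt (exch P ρ) 0 ∈ a := by
    refine mem_iff_mem_of_agree fun i => ?_
    rw [lpt_exch_zero]
    by_cases hi : i ∈ P
    · exact Or.inr (mem_filter.1 hi).2
    · exact Or.inl (by rw [if_neg hi])
  have hb : lpt ρ 1 ∈ b ↔ lpt (exch P ρ) 0 ∈ b := by
    refine mem_iff_mem_of_agree fun i => ?_
    rw [lpt_exch_zero]
    by_cases hi : i ∈ P
    · exact Or.inl (by rw [if_pos hi])
    · rcases hab i with h | h
      · exact absurd (mem_filter.2 ⟨mem_univ _, h⟩) hi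
      · exact Or.inr h
  have ea : ind a (lpt ρ 0) = ind a (lpt (exch P ρ) 0) := by
    by_cases h : lpt ρ 0 ∈ a
    · rw [ind_of_mem h, ind_of_mem (ha.1 h)]
    · rw [ind_of_not_mem h, ind_of_not_mem (fun h' => h (ha.2 h'))]
  have eb : ind b (lpt ρ 1) = ind b (lpt (exch P ρ) 0) := by
    by_cases h : lpt ρ 1 ∈ b
    · rw [ind_of_mem h, ind_of_mem (hb.1 h)]
    · rw [ind_of_not_mem h, ind_of_not_mem (fun h' => h (hb.2 h'))]
  simp only [ea, eb, lpt_exch_two]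

/-- Hence for `a ⊥ b`: `latinTriples a b c = latinPairs (a ∩ b) c`. [this work] -/
theorem latinTriples_eq_of_indep {a b : Finset (Pt ι)} (hab : Indep a b) (c : Finset (Pt ι)) :
    latinTriples a b c = latinPairs (a ∩ b) c := by
  unfold latinTriples
  rw [sum_lpt_abc_eq_of_indep hab c, ← sum_pair02]
  exact sum_congr rfl fun ρ _ => by rw [ind_inter]

/-- **THE INDEPENDENT-PAIR FORMULA** (all `d`, any index type): for `a ⊥ b`,
`κ(a,b,c) = HS(a∩c, b) + HS(a, b∩c)` — two Harris slacks (`…SahiLatinFunctionals.kappa_eq_functionals` + the count above). [this work] -/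
theorem kappa_eq_of_indep {a b : Finset (Pt ι)} (hab : Indep a b) (c : Finset (Pt ι)) :
    kappa a b c = HS (a ∩ c) b + HS a (b ∩ c) := by
  rw [kappa_eq_functionals, latinTriples_eq_of_indep hab, HS_eq, HS_eq, S1_eq, latinPairs_comm (b ∩ c) a, inter_right_comm a c b,
    ← inter_assoc a b c]
  ring

/-- **Independent sets have zero slack**: `a ⊥ b ⟹ HS(a, b) = 0` (any finite sets; from the formula with `c = Ω`:
`HS(a,b) = κ(a,b,Ω) = 2·HS(a,b)`). [this work] -/
theorem HS_eq_zero_of_indep {a b : Finset (Pt ι)} (hab : Indep a b) : HS a b = 0 := by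
  have h1 : kappa a b univ = HS a b + HS a b := by rw [kappa_eq_of_indep hab, inter_univ, inter_univ]
  have h2 : kappa a b univ = HS a b := by rw [kappa_swap23, kappa_swap12, kappa_univ_eq_HS]
  linarith

/-- **`HS(a,b) = 0 ⟺ a ⊥ b`** for up-sets of `[3]^ι` (every index type; the Sahi cell's `sStarD_univ_eq_zero_iff` for `ι = Fin d`). [this work] -/
theorem HS_eq_zero_iff_indep {a b : Finset (Pt ι)} (ha : IsUpperSet (a : Set (Pt ι))) (hb : IsUpperSet (b : Set (Pt ι))) :
    HS a b = 0 ↔ Indep a b :=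
  ⟨indep_of_HS_eq_zero ha hb, HS_eq_zero_of_indep⟩

/-- `κ(Ω,a,b) = 0 ⟺ a ⊥ b` for up-sets. [this work] -/
theorem kappa_univ_eq_zero_iff_indep {a b : Finset (Pt ι)} (ha : IsUpperSet (a : Set (Pt ι))) (hb : IsUpperSet (b : Set (Pt ι))) :
    kappa univ a b = 0 ↔ Indep a b := by
  rw [kappa_univ_eq_HS]; exact HS_eq_zero_iff_indep ha hb

/-- For an independent pair of up-sets (and any up-set `c`) the kernel is nonnegative — FBP on the independent-pair face, every `d`. [this work] -/
theorem kappa_nonneg_of_indep {a b c : Finset (Pt ι)} (hup : UpTriple a b c) (hab : Indep a b) : 0 ≤ kappa a b c := by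
  have hac : IsUpperSet ((a ∩ c : Finset (Pt ι)) : Set (Pt ι)) := by rw [coe_inter]; exact hup.1.inter hup.2.2
  have hbc : IsUpperSet ((b ∩ c : Finset (Pt ι)) : Set (Pt ι)) := by rw [coe_inter]; exact hup.2.1.inter hup.2.2
  rw [kappa_eq_of_indep hab]
  exact add_nonneg (HS_nonneg hac hup.2.1) (HS_nonneg hup.1 hbc)

/-- For an independent pair of up-sets, a zero of the kernel has BOTH slacks zero: `a∩c ⊥ b`-slack and `a ⊥ b∩c`-slack. [this work] -/
theorem HS_eq_zero_of_indep_of_kappa_eq_zero {a b c : Finset (Pt ι)} (hup : UpTriple a b c) (hab : Indep a b)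
    (h0 : kappa a b c = 0) : HS (a ∩ c) b = 0 ∧ HS a (b ∩ c) = 0 := by
  have hac : IsUpperSet ((a ∩ c : Finset (Pt ι)) : Set (Pt ι)) := by rw [coe_inter]; exact hup.1.inter hup.2.2
  have hbc : IsUpperSet ((b ∩ c : Finset (Pt ι)) : Set (Pt ι)) := by rw [coe_inter]; exact hup.2.1.inter hup.2.2
  have h1 := HS_nonneg hac hup.2.1
  have h2 := HS_nonneg hup.1 hbc
  rw [kappa_eq_of_indep hab] at h0
  constructor <;> linarith

/-- Hence, for an independent pair of up-sets, at a zero: `a∩c ⊥ b` and `a ⊥ b∩c`. [this work] -/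
theorem indep_inter_of_indep_of_kappa_eq_zero {a b c : Finset (Pt ι)} (hup : UpTriple a b c) (hab : Indep a b)
    (h0 : kappa a b c = 0) : Indep (a ∩ c) b ∧ Indep a (b ∩ c) := by
  have hac : IsUpperSet ((a ∩ c : Finset (Pt ι)) : Set (Pt ι)) := by rw [coe_inter]; exact hup.1.inter hup.2.2
  have hbc : IsUpperSet ((b ∩ c : Finset (Pt ι)) : Set (Pt ι)) := by rw [coe_inter]; exact hup.2.1.inter hup.2.2
  obtain ⟨h1, h2⟩ := HS_eq_zero_of_indep_of_kappa_eq_zero hup hab h0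
  exact ⟨indep_of_HS_eq_zero hac hup.2.1 h1, indep_of_HS_eq_zero hup.1 hbc h2⟩

end Indep

end Summit.CriticalPhenomena.PercolationContinuityZ3.Theorems.SahiLatin
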